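import Summits.Ventures.LatticeQCDFlow.Scaling.HubChainSpectralGap
import Summits.Ventures.LatticeQCDFlow.Scaling.HubChainTransitionLaw

/-!
HONEST FRAMING: exact (Metropolis-corrected) sampling algorithms for lattice gauge theory; figures
of merit are autocorrelation/cost numbers at stated couplings and volumes; no continuum-physics
claim.

# HubChainVarianceDecay — THE SWAP PHASE SOLVED EXACTLY, XIV: EXACT VARIANCE DECAY `Var_ρ(Pⁿg) = Σ_k β_k²ⁿ a_k²‖f_k‖²_ρ`, HENCE `Var_ρ(Pⁿg) ≤ Λ²ⁿ·Var_ρ(g)` FOR ANY `Λ ≥ max(|β_1|, β_{m−1})`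
# — EVERY OBSERVABLE OF THE HUB PARTICLE EQUILIBRATES WITHIN THE SWAP PHASE AT THE EXPLICIT RATES `β_k²` (lean-2 GEN-39, ours)

Venture-side (OURS).  Cell `lqcd-flow` (pub-lqcd), unit `pub-lqcd-lean-2-g39`, 2026-08-30.  Chapter Y, file 14.  Setting of files 1, 2, 4.  For `g` on the ranks with coefficients
`a_k = ⟨f_k,g⟩_ρ/‖f_k‖²` and `ḡ = Σρg` (file 4): by the left eigen-equation iterated, `⟨f_k, Pⁿg⟩_ρ = β_kⁿ⟨f_k,g⟩_ρ` and `Σρ·Pⁿg = ḡ`, so Parseval (file 4) applied to `Pⁿg` gives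

* `hubChain_pow_mean` (`Σ_iρ_i(Pⁿg)(i) = ḡ`), `hubChain_pow_coeff` (`⟨f_k,Pⁿg⟩_ρ = β_kⁿ·a_k‖f_k‖²`);
* **`hubChain_pow_normSq`**: `Σ_iρ_i(Pⁿg)(i)² = ḡ²/R_m + Σ_k β_k²ⁿa_k²·ρ_kR_kR_{k+1}` (exact);
* **`hubChain_variance_decay`**: if `|β_k| ≤ Λ` for `1 ≤ k < m`, then `Σ_iρ_i(Pⁿg)(i)² − ḡ²/R_m ≤ Λ²ⁿ·(Σ_iρ_ig(i)² − ḡ²/R_m)`, i.e. `Var_ρ(Pⁿg) ≤ Λ²ⁿVar_ρ(g)` (un-normalised `ρ`);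
  with file 1's bounds one may take `Λ = max(cm − 1, 1 − c)` (`β ∈ [1−cm, 1−c]`), i.e. `Λ = 1 − 1/K` for `c = 1/K`, `m = K+1`, `K ≥ 2`.

Reading (no numerics implied): the swap phase forgets the initial hub particle in `ℓ²(ρ)` at rate `(1 − 1/K)²` per attempt whatever the persistences (file 4 gave the form bound; this is the
iterated, exact version).  Literature grade (cell rule): OWN, elementary; nothing cited; no new bib keys.
-/

open Finset

namespace Summit.Ventures.LatticeQCDFlow.Scaling

section VarDecay
variable {m : ℕ} {ρ R β : ℕ → ℝ} {c : ℝ} {P f : ℕ → ℕ → ℝ} {Pn : ℕ → ℕ → ℕ → ℝ} {g a : ℕ → ℝ} {gbar : ℝ}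

/-- **The left eigen-equation iterated:** `Σ_{i<m} ρ_if_k(i)Pⁿ(i,j) = β_kⁿρ_jf_k(j)`. [ours] -/
theorem hubChain_pow_eigen_left (hρ : ∀ i, 0 < ρ i) (hmono : Monotone ρ) (hR : ∀ k, R k = ∑ i ∈ range k, ρ i)
    (hPoff : ∀ i j, i ≠ j → P i j = c * min 1 (ρ j / ρ i)) (hPdiag : ∀ i, P i i = 1 - ∑ j ∈ (range m).erase i, P i j)
    (hf : ∀ k i, f k i = if i < k then ρ k else if i = k then -R k else 0)
    (hβ : ∀ k, β k = 1 - c * (((m - k : ℕ) : ℝ) + R k / ρ k))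
    (hP0 : ∀ i j, Pn 0 i j = if i = j then 1 else 0) (hPs : ∀ n i j, Pn (n + 1) i j = ∑ l ∈ range m, Pn n i l * P l j)
    (n : ℕ) {k j : ℕ} (hk : k < m) (hj : j < m) : ∑ i ∈ range m, ρ i * f k i * Pn n i j = β k ^ n * (ρ j * f k j) := by
  classical
  induction n generalizing j with
  | zero =>
      simp_rw [hP0]
      rw [pow_zero, one_mul]
      rw [Finset.sum_eq_single j (fun i _ hij => by rw [if_neg hij, mul_zero]) (fun h => absurd (mem_range.mpr hj) h)]
      simp
  | succ n ih =>
      simp_rw [hPs, mul_sum]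
      rw [sum_comm]
      calc ∑ l ∈ range m, ∑ i ∈ range m, ρ i * f k i * (Pn n i l * P l j) = ∑ l ∈ range m, (β k ^ n * (ρ l * f k l)) * P l j := by
            refine sum_congr rfl fun l hl => ?_
            rw [← ih (mem_range.mp hl), sum_mul]
            exact sum_congr rfl fun i _ => by ring
        _ = β k ^ n * ∑ l ∈ range m, ρ l * f k l * P l j := by rw [mul_sum]; exact sum_congr rfl fun l _ => by ring
        _ = β k ^ (n + 1) * (ρ j * f k j) := by rw [hubChain_eigen_left hρ hmono hR hPoff hPdiag hf hβ hk hj, pow_succ]; ring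

/-- **Stationarity iterated:** `Σ_{i<m}ρ_iPⁿ(i,j) = ρ_j`. [ours] -/
theorem hubChain_pow_stationary (hρ : ∀ i, 0 < ρ i) (hPoff : ∀ i j, i ≠ j → P i j = c * min 1 (ρ j / ρ i))
    (hPdiag : ∀ i, P i i = 1 - ∑ j ∈ (range m).erase i, P i j)
    (hP0 : ∀ i j, Pn 0 i j = if i = j then 1 else 0) (hPs : ∀ n i j, Pn (n + 1) i j = ∑ l ∈ range m, Pn n i l * P l j)
    (n : ℕ) {j : ℕ} (hj : j < m) : ∑ i ∈ range m, ρ i * Pn n i j = ρ j := by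
  classical
  induction n generalizing j with
  | zero =>
      simp_rw [hP0]
      rw [Finset.sum_eq_single j (fun i _ hij => by rw [if_neg hij, mul_zero]) (fun h => absurd (mem_range.mpr hj) h)]
      simp
  | succ n ih =>
      simp_rw [hPs, mul_sum]
      rw [sum_comm]
      calc ∑ l ∈ range m, ∑ i ∈ range m, ρ i * (Pn n i l * P l j) = ∑ l ∈ range m, ρ l * P l j := by
            refine sum_congr rfl fun l hl => ?_
            rw [← ih (mem_range.mp hl), sum_mul]
            exact sum_congr rfl fun i _ => by ring
        _ = ρ j := hubChain_rho_stationary hρ hPoff hPdiag hj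

/-- **The mean is preserved:** `Σ_iρ_i(Pⁿg)(i) = ḡ`. [ours] -/
theorem hubChain_pow_mean (hρ : ∀ i, 0 < ρ i) (hPoff : ∀ i j, i ≠ j → P i j = c * min 1 (ρ j / ρ i))
    (hPdiag : ∀ i, P i i = 1 - ∑ j ∈ (range m).erase i, P i j)
    (hP0 : ∀ i j, Pn 0 i j = if i = j then 1 else 0) (hPs : ∀ n i j, Pn (n + 1) i j = ∑ l ∈ range m, Pn n i l * P l j)
    (hgbar : gbar = ∑ j ∈ range m, ρ j * g j) (n : ℕ) :
    ∑ i ∈ range m, ρ i * ∑ j ∈ range m, Pn n i j * g j = gbar := by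
  rw [hgbar]
  simp_rw [mul_sum]
  rw [sum_comm]
  refine sum_congr rfl fun j hj => ?_
  rw [← hubChain_pow_stationary hρ hPoff hPdiag hP0 hPs n (mem_range.mp hj), sum_mul]
  exact sum_congr rfl fun i _ => by ring

/-- **The coefficients of `Pⁿg`:** `Σ_iρ_if_k(i)(Pⁿg)(i) = β_kⁿ·Σ_jρ_jf_k(j)g(j)`. [ours] -/
theorem hubChain_pow_coeff (hρ : ∀ i, 0 < ρ i) (hmono : Monotone ρ) (hR : ∀ k, R k = ∑ i ∈ range k, ρ i)
    (hPoff : ∀ i j, i ≠ j → P i j = c * min 1 (ρ j / ρ i)) (hPdiag : ∀ i, P i i = 1 - ∑ j ∈ (range m).erase i, P i j)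
    (hf : ∀ k i, f k i = if i < k then ρ k else if i = k then -R k else 0)
    (hβ : ∀ k, β k = 1 - c * (((m - k : ℕ) : ℝ) + R k / ρ k))
    (hP0 : ∀ i j, Pn 0 i j = if i = j then 1 else 0) (hPs : ∀ n i j, Pn (n + 1) i j = ∑ l ∈ range m, Pn n i l * P l j)
    (n : ℕ) {k : ℕ} (hk : k < m) :
    ∑ i ∈ range m, ρ i * f k i * ∑ j ∈ range m, Pn n i j * g j = β k ^ n * ∑ j ∈ range m, ρ j * f k j * g j := by
  simp_rw [mul_sum]
  rw [sum_comm]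
  refine sum_congr rfl fun j hj => ?_
  rw [show (∑ i ∈ range m, ρ i * f k i * (Pn n i j * g j)) = (∑ i ∈ range m, ρ i * f k i * Pn n i j) * g j by
    rw [sum_mul]; exact sum_congr rfl fun i _ => by ring]
  rw [hubChain_pow_eigen_left hρ hmono hR hPoff hPdiag hf hβ hP0 hPs n hk (mem_range.mp hj)]
  ring

/-- **EXACT NORM OF `Pⁿg`:** `Σ_iρ_i(Pⁿg)(i)² = ḡ²/R_m + Σ_k β_k²ⁿa_k²·ρ_kR_kR_{k+1}`. [ours] -/
theorem hubChain_pow_normSq (hρ : ∀ i, 0 < ρ i) (hmono : Monotone ρ) (hR : ∀ k, R k = ∑ i ∈ range k, ρ i)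
    (hPoff : ∀ i j, i ≠ j → P i j = c * min 1 (ρ j / ρ i)) (hPdiag : ∀ i, P i i = 1 - ∑ j ∈ (range m).erase i, P i j)
    (hf : ∀ k i, f k i = if i < k then ρ k else if i = k then -R k else 0)
    (hβ : ∀ k, β k = 1 - c * (((m - k : ℕ) : ℝ) + R k / ρ k))
    (hP0 : ∀ i j, Pn 0 i j = if i = j then 1 else 0) (hPs : ∀ n i j, Pn (n + 1) i j = ∑ l ∈ range m, Pn n i l * P l j)
    (ha : ∀ k, a k = (∑ j ∈ range m, ρ j * f k j * g j) / (ρ k * R k * R (k + 1))) (hgbar : gbar = ∑ j ∈ range m, ρ j * g j) (n : ℕ) :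
    ∑ i ∈ range m, ρ i * (∑ j ∈ range m, Pn n i j * g j) ^ 2 = gbar ^ 2 / R m + ∑ k ∈ range m, (β k ^ n * a k) ^ 2 * (ρ k * R k * R (k + 1)) := by
  -- Parseval (file 4) for `g' = Pⁿg` with its own coefficients `a'`, then `a'_k = β_kⁿa_k` below `m` and `ḡ' = ḡ`
  obtain ⟨a', ha'⟩ : ∃ a' : ℕ → ℝ, ∀ k, a' k = (∑ j ∈ range m, ρ j * f k j * (∑ l ∈ range m, Pn n j l * g l)) / (ρ k * R k * R (k + 1)) := ⟨_, fun _ => rfl⟩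
  have hmean := hubChain_pow_mean (g := g) hρ hPoff hPdiag hP0 hPs hgbar n
  rw [hubChain_parseval hρ hR hf ha' hmean.symm]
  congr 1
  refine sum_congr rfl fun k hk => ?_
  rw [ha' k, hubChain_pow_coeff hρ hmono hR hPoff hPdiag hf hβ hP0 hPs n (mem_range.mp hk), ha k, mul_div_assoc]

/-- **EXACT VARIANCE DECAY OF THE SWAP PHASE:** if `|β_k| ≤ Λ` for `1 ≤ k < m`, then `Σ_iρ_i(Pⁿg)(i)² − ḡ²/R_m ≤ Λ²ⁿ·(Σ_iρ_ig(i)² − ḡ²/R_m)` (`Var_ρ(Pⁿg) ≤ Λ²ⁿ·Var_ρ(g)`). [ours] -/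
theorem hubChain_variance_decay (hρ : ∀ i, 0 < ρ i) (hmono : Monotone ρ) (hR : ∀ k, R k = ∑ i ∈ range k, ρ i)
    (hPoff : ∀ i j, i ≠ j → P i j = c * min 1 (ρ j / ρ i)) (hPdiag : ∀ i, P i i = 1 - ∑ j ∈ (range m).erase i, P i j)
    (hf : ∀ k i, f k i = if i < k then ρ k else if i = k then -R k else 0)
    (hβ : ∀ k, β k = 1 - c * (((m - k : ℕ) : ℝ) + R k / ρ k))
    (hP0 : ∀ i j, Pn 0 i j = if i = j then 1 else 0) (hPs : ∀ n i j, Pn (n + 1) i j = ∑ l ∈ range m, Pn n i l * P l j)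
    (hgbar : gbar = ∑ j ∈ range m, ρ j * g j) {Λ : ℝ} (hΛ : ∀ k, 1 ≤ k → k < m → |β k| ≤ Λ) (n : ℕ) :
    ∑ i ∈ range m, ρ i * (∑ j ∈ range m, Pn n i j * g j) ^ 2 - gbar ^ 2 / R m ≤ Λ ^ (2 * n) * (∑ i ∈ range m, ρ i * g i ^ 2 - gbar ^ 2 / R m) := by
  obtain ⟨a, ha⟩ : ∃ a : ℕ → ℝ, ∀ k, a k = (∑ j ∈ range m, ρ j * f k j * g j) / (ρ k * R k * R (k + 1)) := ⟨_, fun _ => rfl⟩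
  rw [hubChain_pow_normSq hρ hmono hR hPoff hPdiag hf hβ hP0 hPs ha hgbar n, hubChain_parseval hρ hR hf ha hgbar]
  rw [add_sub_cancel_left, add_sub_cancel_left, mul_sum]
  refine sum_le_sum fun k hk => ?_
  have hRk : 0 ≤ R k := by rw [hR k]; exact sum_nonneg fun i _ => (hρ i).le
  have hRk1 : 0 ≤ R (k + 1) := by rw [hR (k + 1)]; exact sum_nonneg fun i _ => (hρ i).le
  have hN : 0 ≤ a k ^ 2 * (ρ k * R k * R (k + 1)) := mul_nonneg (sq_nonneg _) (mul_nonneg (mul_nonneg (hρ k).le hRk) hRk1)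
  rcases Nat.eq_zero_or_pos k with hk0 | hk0
  · subst hk0
    have : R 0 = 0 := by rw [hR 0, sum_range_zero]
    rw [this]; simp
  · have hb : |β k| ≤ Λ := hΛ k hk0 (mem_range.mp hk)
    have hb2 : (β k ^ n) ^ 2 ≤ Λ ^ (2 * n) := by
      have e1 : (β k ^ n) ^ 2 = (|β k| ^ 2) ^ n := by rw [sq_abs, ← pow_mul, ← pow_mul, mul_comm]
      have e2 : Λ ^ (2 * n) = (Λ ^ 2) ^ n := by rw [pow_mul]
      rw [e1, e2]
      have hsq : |β k| ^ 2 ≤ Λ ^ 2 := pow_le_pow_left₀ (abs_nonneg _) hb 2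
      exact pow_le_pow_left₀ (sq_nonneg _) hsq n
    calc (β k ^ n * a k) ^ 2 * (ρ k * R k * R (k + 1)) = (β k ^ n) ^ 2 * (a k ^ 2 * (ρ k * R k * R (k + 1))) := by ring
      _ ≤ Λ ^ (2 * n) * (a k ^ 2 * (ρ k * R k * R (k + 1))) := mul_le_mul_of_nonneg_right hb2 hN

/-- The uniform rate from file 1's bounds: `|β_k| ≤ max(cm − 1, 1 − c)` for `k < m` (`c ≥ 0`). [ours] -/
theorem hubChain_beta_abs_le (hρ : ∀ i, 0 < ρ i) (hmono : Monotone ρ) (hR : ∀ k, R k = ∑ i ∈ range k, ρ i)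
    (hβ : ∀ k, β k = 1 - c * (((m - k : ℕ) : ℝ) + R k / ρ k)) (hc : 0 ≤ c) {k : ℕ} (hk : k < m) : |β k| ≤ max (c * m - 1) (1 - c) := by
  have h1 := hubChain_beta_le hρ hmono hR hβ hc hk
  have h2 := hubChain_beta_ge hρ hmono hR hβ hc hk
  rw [abs_le]
  constructor
  · have : -(max (c * m - 1) (1 - c)) ≤ -(c * m - 1) := neg_le_neg (le_max_left _ _)
    linarith
  · exact h1.trans (le_max_right _ _)

end VarDecay

end Summit.Ventures.LatticeQCDFlow.Scaling
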